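import Mathlib
import Summits.Langlands.Langlands.Theorems.QuadraticWindowHostInducedRepPaneDefs
import Summits.Langlands.Langlands.Theorems.QuadraticWindowHostInducedRepPackageDict
import Summits.Langlands.Langlands.Theorems.QuadraticWindowHostInducedRepPackageHecke
import Summits.Langlands.Langlands.Theorems.QuadraticWindowHostInducedRepPackagePolar
import Summits.Langlands.Langlands.Theorems.HostInducedRep.Negative.AsaiSignHazard
import Literature.NumberTheory.Automorphic.AutomorphicTwistHecke
import Literature.NumberTheory.Automorphic.BaseChangeOfAutomorphicInduction
import Literature.NumberTheory.GaloisRepresentations.HeckeCharacterCofiniteProofs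
import Literature.NumberTheory.GaloisRepresentations.HeckeLFunctionAnalyticProofs
import Literature.NumberTheory.GaloisRepresentations.ArtinReciprocityCharacterProofs
import Literature.NumberTheory.QuadraticForms.QuadraticExtensionPlaces

/-!
# Sub-stub `stub_memberSatake` of the member statement (stub `stub_package`, line
# `one-transparent-pane`, crux `Summit.Langlands.Langlands.Theses.QuadraticWindow.HostInducedRep`,
# item stmt-Langlands-10902) — helper file 3: the almost-everywhere Satake data of a member

LOG (wave-3 worker `stub_memberSatake`, 2026-08-16).  FACT-FREE (theorems only).

* §1 small algebra: `(q^{-k/2})² = q^{-k}`, stability `B = -B` of the square roots of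
  a multiset, two distinct places above `v` in a quadratic extension mean `v` split
  (`ncard_primesOver_eq_two_of_smul_ne`), the fibre of `v` in a quadratic extension and the induced
  parameter (`induced_inert`, `induced_split`), and the restriction identity at a pair of conjugate
  places (`restrict_pair`: `χ|_{F₀}(ϖ_v) = χ(ϖ_w) χ(ϖ_{cw})` resp. `= χ(ϖ_w)`).
* §2 `eventually_memberData`: at almost every place `v` of `F₀` (unramified in `F` and `K`), from the
  a.e. relations of `MemberRel` — Satake parameters `α_w` of `π` above `v` with the polarization
  `Sat(π, τw) = α_w⁻¹ (χe(ϖ_v) q_v^k)^{f(w|v)}` (`hpol` + the Frobenius values of the avatar `e`), the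
  induced parameter `B_v` of `Pind = AI(π ⊗ ω)` (`∏ (X - b) = ∏_{w|v} ∏_{a} (X^{f} - a ω(ϖ_w))`) and its
  polarization `B_v⁻¹ = B_v θ_v`, `θ_v = (χe(ϖ_v) q_v^k ω₀(ϖ_v))⁻¹` (landed `inducedParam_map_inv`,
  `ω₀(ϖ_v) = ∏_{w|v} ω(ϖ_w)`), the admissibility values of `μ`, and above `v`: `ψu` unramified,
  `Sat(Π_K, u) = B_v^{f(u|v)}`, `Sat(τ', u) = B_v^{f(u|v)} ψ₀(ϖ_u)`, `χ₀(ϖ_v) = ∏_{u|v} ψu(ϖ_u)`,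
  `ω₀(ϖ_v) = ∏_{w|v} ω(ϖ_w)`.
[cite: ArthurClozelAMS120, Ch. 3 Def. 6.1, (6.1)–(6.2)]
-/

open scoped BigOperators Polynomial Classical
open Filter Set Polynomial IsDedekindDomain NumberField
open Literature.NumberTheory.Automorphic Literature.NumberTheory.GaloisRepresentations
open Literature.NumberTheory.QuadraticForms Literature.NumberTheory.QuadraticForms.QuadraticExtension
open Summit.Langlands.Langlands.Theorems.HostInducedRep.GrsExplicitDescent
open Summit.Langlands.Langlands.Theorems.HostInducedRep.Negative

-- `Summit.Langlands.Langlands.…` (summit = sub-problem name, D-0017 layout) trips `dupNamespace`.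
set_option linter.dupNamespace false

noncomputable section

namespace Summit.Langlands.Langlands.Theorems.HostInducedRep.OneTransparentPane
/-! ## §1 Small algebra and fibre lemmas -/

section Algebra

/-- `(q^{-k/2})² = (q^k)⁻¹` in `ℂ` (`q : ℕ`, `k : ℤ`). [folklore] -/
theorem cpow_neg_half_sq (q : ℕ) (k : ℤ) :
    ((q : ℂ) ^ (-((k : ℂ) / 2))) ^ 2 = ((q : ℂ) ^ k)⁻¹ := by
  rw [← Complex.cpow_nat_mul]
  push_cast
  rw [show (2 : ℂ) * -((k : ℂ) / 2) = -(k : ℂ) by ring, Complex.cpow_neg, Complex.cpow_intCast]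

/-- `((q²)^{-k/2})² = (q^k)⁻²`. [folklore] -/
theorem cpow_neg_half_sq_sq (q : ℕ) (k : ℤ) :
    (((q ^ 2 : ℕ) : ℂ) ^ (-((k : ℂ) / 2))) ^ 2 = (((q : ℂ) ^ k) ^ 2)⁻¹ := by
  rw [cpow_neg_half_sq, Nat.cast_pow, ← zpow_natCast ((q : ℂ) ^ k), ← zpow_natCast (q : ℂ),
    ← zpow_mul, ← zpow_mul, mul_comm]

/-- The multiset of square roots of a multiset is stable under negation: if
`∏_{b ∈ B} (X - b) = (∏_{a ∈ A} (X - a))(X²)` then `-B = B`. [folklore] -/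
theorem map_neg_eq_self_of_comp_sq {B A : Multiset ℂ}
    (h : satakePolynomial B = (satakePolynomial A).comp (X ^ 2)) : B.map (· * (-1)) = B := by
  have h' : satakePolynomial B = ∏ i ∈ ({(0 : ℕ)} : Finset ℕ), (satakePolynomial A).comp (X ^ 2) := by
    rw [Finset.prod_singleton, h]
  have := Multiset.map_mul_eq_self_of_satakePolynomial_eq {(0 : ℕ)} (fun _ ↦ A) two_pos h'
    (ζ := -1) (by norm_num)
  rw [show B.map (· * (-1)) = B.map (fun x ↦ (-1 : ℂ) * x) from
    Multiset.map_congr rfl fun b _ ↦ mul_comm _ _]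
  exact this

end Algebra

section Fibre

variable {F₀ M : Type} [Field F₀] [NumberField F₀] [Field M] [NumberField M] [Algebra F₀ M]

/-- **Two distinct places above `v` in a quadratic extension: `v` is split** (two primes above `v`).
[folklore] -/
theorem ncard_primesOver_eq_two_of_smul_ne (h2 : Module.finrank F₀ M = 2) {c : M ≃ₐ[F₀] M}
    {w : HeightOneSpectrum (𝓞 M)} (hne : c • w ≠ w) :
    ((w.under (𝓞 F₀)).asIdeal.primesOver (𝓞 M)).ncard = 2 := by
  haveI : Algebra.IsQuadraticExtension F₀ M := ⟨h2⟩
  rw [← ncard_finitePlacesOver_eq_ncard_primesOver]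
  rcases ncard_finitePlacesOver_eq_one_or_two (E := M) (w.under (𝓞 F₀)) with h | h
  · exact absurd (smul_eq_of_ncard_finitePlacesOver_eq_one h c (show w ∈ finitePlacesOver M _ from rfl)) hne
  · exact h

/-- **The fibre of an INERT `v` and the induced parameter**: if `τ` fixes a place `w₀` above `v`
(unramified in the quadratic `M`), then `w₀` is the only place above `v`, `f(w₀|v) = 2`, and a
multiset `B` inducing the family `A` at `v` consists of the square roots of `A w₀`. [folklore] -/
theorem induced_inert (h2 : Module.finrank F₀ M = 2) {τ : M ≃ₐ[F₀] M} (hτ : τ ≠ 1)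
    {v : HeightOneSpectrum (𝓞 F₀)} {w₀ : HeightOneSpectrum (𝓞 M)} (hw₀ : w₀.under (𝓞 F₀) = v)
    (hfix : τ • w₀ = w₀) (hv : Algebra.IsUnramifiedIn (𝓞 M) v.asIdeal) {B : Multiset ℂ}
    {A : HeightOneSpectrum (𝓞 M) → Multiset ℂ} (hB : satakePolynomial B = inducedSatakePolynomial v A) :
    (∀ w : HeightOneSpectrum (𝓞 M), w.under (𝓞 F₀) = v → w = w₀) ∧ w₀.asIdeal.inertiaDeg (𝓞 F₀) = 2 ∧
      satakePolynomial B = (satakePolynomial (A w₀)).comp (X ^ 2) := by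
  -- adapted from Theorems/QuadraticWindowHostInducedRepPackagePolar.lean (`inducedParam_map_inv`, inert case)
  have hfib : ∀ w : HeightOneSpectrum (𝓞 M), w.under (𝓞 F₀) = v → w = w₀ := fun w hw ↦ by
    rcases HeightOneSpectrum.eq_or_eq_smul_of_under_eq h2 hτ (hw.trans hw₀.symm) with h | h
    · exact h
    · rw [h, hfix]
  have hset' : {w : HeightOneSpectrum (𝓞 M) | w.asIdeal.under (𝓞 F₀) = v.asIdeal} = {w₀} := by
    ext w
    simp only [Set.mem_setOf_eq, Set.mem_singleton_iff, ← place_under_eq_iff_asIdeal]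
    exact ⟨hfib w, fun h ↦ h ▸ hw₀⟩
  have hf2 : w₀.asIdeal.inertiaDeg (𝓞 F₀) = 2 :=
    inertiaDeg_eq_two_of_smul_eq_of_isUnramifiedIn h2 hτ hfix (by rw [hw₀]; exact hv)
  refine ⟨hfib, hf2, ?_⟩
  rw [hB, inducedSatakePolynomial, hset', finprod_mem_singleton, hf2]

/-- **The fibre of a SPLIT `v` and the induced parameter**: if `τ` moves a place `w₀` above `v`, the
places above `v` are `w₀, τw₀`, both of residue degree `1`, and `B = A w₀ + A (τw₀)`. [folklore] -/
theorem induced_split (h2 : Module.finrank F₀ M = 2) {τ : M ≃ₐ[F₀] M} (hτ : τ ≠ 1)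
    {v : HeightOneSpectrum (𝓞 F₀)} {w₀ : HeightOneSpectrum (𝓞 M)} (hw₀ : w₀.under (𝓞 F₀) = v)
    (hfix : τ • w₀ ≠ w₀) {B : Multiset ℂ} {A : HeightOneSpectrum (𝓞 M) → Multiset ℂ}
    (hB : satakePolynomial B = inducedSatakePolynomial v A) :
    (∀ w : HeightOneSpectrum (𝓞 M), w.under (𝓞 F₀) = v → w = w₀ ∨ w = τ • w₀) ∧
      (τ • w₀).under (𝓞 F₀) = v ∧ w₀.asIdeal.inertiaDeg (𝓞 F₀) = 1 ∧
      (τ • w₀).asIdeal.inertiaDeg (𝓞 F₀) = 1 ∧ B = A w₀ + A (τ • w₀) := by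
  -- adapted from Theorems/QuadraticWindowHostInducedRepPackagePolar.lean (`inducedParam_map_inv`, split case)
  have hτw₀ : (τ • w₀).under (𝓞 F₀) = v := by
    rw [HeightOneSpectrum.under_algEquiv_smul F₀ M τ w₀, hw₀]
  have hfib : ∀ w : HeightOneSpectrum (𝓞 M), w.under (𝓞 F₀) = v → w = w₀ ∨ w = τ • w₀ := fun w hw ↦
    HeightOneSpectrum.eq_or_eq_smul_of_under_eq h2 hτ (hw.trans hw₀.symm)
  have hne : w₀ ≠ τ • w₀ := fun h ↦ hfix h.symm
  have hset' : {w : HeightOneSpectrum (𝓞 M) | w.asIdeal.under (𝓞 F₀) = v.asIdeal} = {w₀, τ • w₀} := by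
    ext w
    simp only [Set.mem_setOf_eq, Set.mem_insert_iff, Set.mem_singleton_iff, ← place_under_eq_iff_asIdeal]
    refine ⟨hfib w, ?_⟩
    rintro (rfl | rfl)
    · exact hw₀
    · exact hτw₀
  have hf1 : w₀.asIdeal.inertiaDeg (𝓞 F₀) = 1 :=
    HeightOneSpectrum.inertiaDeg_eq_one_of_smul_ne h2 (c := τ) hfix
  have hf1' : (τ • w₀).asIdeal.inertiaDeg (𝓞 F₀) = 1 := by
    rw [HeightOneSpectrum.inertiaDeg_algEquiv_smul, hf1]
  refine ⟨hfib, hτw₀, hf1, hf1', ?_⟩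
  apply eq_of_satakePolynomial_eq
  rw [hB, inducedSatakePolynomial, hset', finprod_mem_pair hne, hf1, hf1', pow_one, comp_X, comp_X,
    satakePolynomial_add]

/-- **The restriction identity at the places above `v`**, quadratic case: if
`χ|_{F₀}(ϖ_v) = ∏_{w ∣ v} χ(ϖ_w)` then `χ|(ϖ_v) = χ(ϖ_w) χ(ϖ_{cw})` when `cw ≠ w` and
`χ|(ϖ_v) = χ(ϖ_w)` when `cw = w`. [folklore] -/
theorem restrict_pair (h2 : Module.finrank F₀ M = 2) {c : M ≃ₐ[F₀] M} (hc : c ≠ 1)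
    {χ : HeckeCharacter M} {χ₀ : HeckeCharacter F₀} {v : HeightOneSpectrum (𝓞 F₀)}
    (hres : χ₀.valueAtUniformizer v = ∏ w ∈ (finite_fibre (F := M) v).toFinset, χ.valueAtUniformizer w)
    {w : HeightOneSpectrum (𝓞 M)} (hw : w.under (𝓞 F₀) = v) :
    (c • w ≠ w → χ₀.valueAtUniformizer v = χ.valueAtUniformizer w * χ.valueAtUniformizer (c • w)) ∧
      (c • w = w → χ₀.valueAtUniformizer v = χ.valueAtUniformizer w) := by
  have hcw : (c • w).under (𝓞 F₀) = v := by rw [HeightOneSpectrum.under_algEquiv_smul F₀ M c w, hw]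
  have hfib : ∀ w' : HeightOneSpectrum (𝓞 M), w'.under (𝓞 F₀) = v → w' = w ∨ w' = c • w := fun w' hw' ↦
    HeightOneSpectrum.eq_or_eq_smul_of_under_eq h2 hc (hw'.trans hw.symm)
  constructor
  · intro hne
    have hset : (finite_fibre (F := M) v).toFinset = {w, c • w} := by
      ext w'
      simp only [Set.Finite.mem_toFinset, Set.mem_setOf_eq, Finset.mem_insert, Finset.mem_singleton]
      refine ⟨hfib w', ?_⟩
      rintro (rfl | rfl)
      · exact hw
      · exact hcw
    rw [hres, hset, Finset.prod_pair (fun h ↦ hne h.symm)]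
  · intro heq
    have hset : (finite_fibre (F := M) v).toFinset = {w} := by
      ext w'
      simp only [Set.Finite.mem_toFinset, Set.mem_setOf_eq, Finset.mem_singleton]
      refine ⟨fun hw' ↦ ?_, fun h ↦ h ▸ hw⟩
      rcases hfib w' hw' with h | h
      · exact h
      · rw [h, heq]
    rw [hres, hset, Finset.prod_singleton]

end Fibre

/-! ## §2 The almost-everywhere Satake data of a member -/

section Data

variable {F₀ F K : Type} [Field F₀] [NumberField F₀] [Field F] [NumberField F] [Algebra F₀ F]
  [Field K] [NumberField K] [Algebra F₀ K]

/-- **The a.e. Satake data of a member** (see the module docstring, §2). [folklore] -/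
theorem eventually_memberData (hdeg : Module.finrank F₀ F = 2) {τ : F ≃ₐ[F₀] F} (hτ : τ ≠ 1) {n : ℕ}
    {hcpt : isCompact_glFiniteIntegralLevel n F}
    (π : CuspidalAutomorphicRepData n F hcpt) (e : FramedGaloisRep F₀ ℂ 1) (k : ℤ)
    (hpol : ∀ᶠ w in cofinite, ∀ (α β : Multiset ℂ) (c : ℂ), π.1.HasSatakeParamAt w α →
      π.1.HasSatakeParamAt (τ • w) β → e.HasFrobCharpolyAt (w.under (𝓞 F₀)) (X - C c) →
      β = α.map (fun a ↦ a⁻¹ * (c * ((w.under (𝓞 F₀)).residueCard : ℂ) ^ k) ^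
        w.asIdeal.inertiaDeg (𝓞 F₀)))
    {χe μ ω₀ : HeckeCharacter F₀} {ω : HeckeCharacter F} (hfin : ω.IsFiniteOrder)
    (hχe : ∀ v : HeightOneSpectrum (𝓞 F₀), e.IsUnramifiedAt v →
      χe.IsUnramifiedAt v ∧ e.HasFrobCharpolyAt v (X - C (χe.valueAtUniformizer v)))
    (hω₀ : ∀ x, ω₀ x = ω (AdeleRing.ideleBaseChange F₀ F x)) (hμ : MuHyp F K μ)
    {ψu νk : HeckeCharacter K}
    (hψures : ∀ x, ψu (AdeleRing.ideleBaseChange F₀ K x) = ((χe * ω₀)⁻¹ * μ) x)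
    {hF₀ : isCompact_glFiniteIntegralLevel (2 * n) F₀} {hK : isCompact_glFiniteIntegralLevel (2 * n) K}
    {Pind : AutomorphicRepData (AutomorphyDatum.gl (2 * n) F₀ hF₀)}
    {PiK τ' : AutomorphicRepData (AutomorphyDatum.gl (2 * n) K hK)}
    (hAI : IsAutomorphicInductionAlong (π.twist ω hfin).1 Pind) (hBC : IsWeakBaseChangeLiftAE Pind PiK)
    (hW : τ'.W = PiK.W.map (mulChar (detTwist (2 * n) (ψu * νk))))
    (hW' : τ'.W' = PiK.W'.map (mulChar (detTwist (2 * n) (ψu * νk)))) :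
    ∀ᶠ v : HeightOneSpectrum (𝓞 F₀) in cofinite,
      ∃ (α : HeightOneSpectrum (𝓞 F) → Multiset ℂ) (B : Multiset ℂ),
      Algebra.IsUnramifiedIn (𝓞 F) v.asIdeal ∧ Algebra.IsUnramifiedIn (𝓞 K) v.asIdeal ∧
      (∀ w : HeightOneSpectrum (𝓞 F), w.under (𝓞 F₀) = v →
        π.1.HasSatakeParamAt w (α w) ∧ ω.IsUnramifiedAt w ∧
        (π.twist ω hfin).1.HasSatakeParamAt w ((α w).map (ω.valueAtUniformizer w * ·)) ∧
        ∀ β : Multiset ℂ, π.1.HasSatakeParamAt (τ • w) β →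
          β = (α w).map (fun a ↦ a⁻¹ * (χe.valueAtUniformizer v * (v.residueCard : ℂ) ^ k) ^
            w.asIdeal.inertiaDeg (𝓞 F₀))) ∧
      Pind.HasSatakeParamAt v B ∧
      satakePolynomial B = inducedSatakePolynomial v (fun w ↦ (α w).map (ω.valueAtUniformizer w * ·)) ∧
      B.map (·⁻¹) = B.map (· * (χe.valueAtUniformizer v * (v.residueCard : ℂ) ^ k *
        ω₀.valueAtUniformizer v)⁻¹) ∧
      ((χe * ω₀)⁻¹ * μ).valueAtUniformizer v =
        (χe.valueAtUniformizer v * ω₀.valueAtUniformizer v)⁻¹ * μ.valueAtUniformizer v ∧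
      μ.valueAtUniformizer v ^ 2 = 1 ∧
      ((v.asIdeal.primesOver (𝓞 K)).ncard = 2 → (v.asIdeal.primesOver (𝓞 F)).ncard = 2 →
        μ.valueAtUniformizer v = 1) ∧
      (∀ u : HeightOneSpectrum (𝓞 K), u.under (𝓞 F₀) = v → ψu.IsUnramifiedAt u ∧
        PiK.HasSatakeParamAt u (B.map (· ^ u.asIdeal.inertiaDeg (𝓞 F₀))) ∧
        τ'.HasSatakeParamAt u
          ((B.map (· ^ u.asIdeal.inertiaDeg (𝓞 F₀))).map ((ψu * νk).valueAtUniformizer u * ·))) ∧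
      ((χe * ω₀)⁻¹ * μ).valueAtUniformizer v =
        ∏ u ∈ (finite_fibre (F := K) v).toFinset, ψu.valueAtUniformizer u ∧
      ω₀.valueAtUniformizer v = ∏ w ∈ (finite_fibre (F := F) v).toFinset, ω.valueAtUniformizer w := by
  have h1 : ∀ᶠ v : HeightOneSpectrum (𝓞 F₀) in cofinite, Algebra.IsUnramifiedIn (𝓞 F) v.asIdeal := by
    filter_upwards [(finite_setOf_not_isUnramifiedIn F₀ F).compl_mem_cofinite] with v hv
    simpa using hv
  have h2 : ∀ᶠ v : HeightOneSpectrum (𝓞 F₀) in cofinite, Algebra.IsUnramifiedIn (𝓞 K) v.asIdeal := by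
    filter_upwards [(finite_setOf_not_isUnramifiedIn F₀ K).compl_mem_cofinite] with v hv
    simpa using hv
  have h3 := AutomorphicRepData.eventually_exists_forall_hasSatakeParamAt_above (K := F₀) π.1
  have h4 := eventually_forall_under_eq (F := F₀) (HeckeCharacter.isUnramifiedAt_cofinite_holds ω)
  have h5 := eventually_forall_under_eq (F := F₀) hpol
  have h6 := FramedArtinRep.eventually_isUnramifiedAt e
  have h8 := eventually_forall_under_eq (F := F₀) (HeckeCharacter.isUnramifiedAt_cofinite_holds ψu)
  have h10 := eventually_forall_under_eq (F := F₀) hBC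
  have h11 := eventually_forall_under_eq (F := F₀)
    (AutomorphicRepData.eventually_hasSatakeParamAt_of_map_mulChar_detTwist (ψu * νk) hW hW')
  filter_upwards [h1, h2, h3, h4, h5, h6, hμ.2, h8, hAI, h10, h11] with v hv1 hv2 hv3 hv4 hv5 hv6 hv7 hv8
    hv9 hv10 hv11
  obtain ⟨α, hα⟩ := hv3
  obtain ⟨-, hμ2, hμ1⟩ := hv7
  -- the twisted parameters and the induced parameter
  have htw : ∀ w : HeightOneSpectrum (𝓞 F), w.asIdeal.under (𝓞 F₀) = v.asIdeal →
      (π.twist ω hfin).1.HasSatakeParamAt w ((α w).map (ω.valueAtUniformizer w * ·)) := fun w hw ↦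
    hasSatakeParamAt_twist_at_unramified_place (hα w hw) hfin (hv4 w hw)
  obtain ⟨B, hB, hBi⟩ := hv9 _ htw
  -- the polarization at the places over `v`
  obtain ⟨-, hefrob⟩ := hχe v hv6
  have hpolv : ∀ w : HeightOneSpectrum (𝓞 F), w.under (𝓞 F₀) = v → ∀ β : Multiset ℂ,
      π.1.HasSatakeParamAt (τ • w) β →
        β = (α w).map (fun a ↦ a⁻¹ * (χe.valueAtUniformizer v * (v.residueCard : ℂ) ^ k) ^
          w.asIdeal.inertiaDeg (𝓞 F₀)) := by
    intro w hw β hβ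
    have hw' := (place_under_eq_iff_asIdeal w v).mp hw
    have h := hv5 w hw' (α w) β (χe.valueAtUniformizer v) (hα w hw') hβ (by rw [hw]; exact hefrob)
    rwa [hw] at h
  have hBi' : satakePolynomial B =
      inducedSatakePolynomial v (fun w ↦ (α w).map (· * ω.valueAtUniformizer w)) := by
    rw [hBi]
    exact inducedSatakePolynomial_congr v fun w _ ↦ Multiset.map_congr rfl fun a _ ↦ mul_comm _ _
  have hram : ∀ w : HeightOneSpectrum (𝓞 F), w.under (𝓞 F₀) = v → w.asIdeal.ramificationIdx (𝓞 F₀) = 1 :=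
    fun w hw ↦ ramificationIdx_eq_one_of_isUnramifiedIn_of_under_eq hv1 hw
  have hqk : χe.valueAtUniformizer v * (v.residueCard : ℂ) ^ k ≠ 0 :=
    mul_ne_zero (Units.ne_zero _)
      (zpow_ne_zero _ (Nat.cast_ne_zero.mpr (zero_lt_one.trans v.one_lt_residueCard).ne'))
  have hinv := inducedParam_map_inv hdeg τ hτ π.1 k hram
    (fun w hw ↦ hα w ((place_under_eq_iff_asIdeal w v).mp hw))
    (fun w _ ↦ show ω.valueAtUniformizer w ≠ 0 from Units.ne_zero _)
    hqk hpolv hBi'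
  have hresω : ω₀.valueAtUniformizer v = ∏ w ∈ (finite_fibre (F := F) v).toFinset, ω.valueAtUniformizer w :=
    valueAtUniformizer_restrict hω₀ hram (fun w hw ↦ hv4 w ((place_under_eq_iff_asIdeal w v).mp hw))
  have hprod : ∏ᶠ w ∈ {w : HeightOneSpectrum (𝓞 F) | w.under (𝓞 F₀) = v}, ω.valueAtUniformizer w =
      ω₀.valueAtUniformizer v := by
    rw [finprod_mem_eq_finite_toFinset_prod _ (finite_fibre v), hresω]
  rw [hprod] at hinv
  have hχ₀v : ((χe * ω₀)⁻¹ * μ).valueAtUniformizer v =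
      (χe.valueAtUniformizer v * ω₀.valueAtUniformizer v)⁻¹ * μ.valueAtUniformizer v := by
    rw [valueAtUniformizer_mul, HeckeCharacter.valueAtUniformizer_inv, valueAtUniformizer_mul]
  have hres : ((χe * ω₀)⁻¹ * μ).valueAtUniformizer v =
      ∏ u ∈ (finite_fibre (F := K) v).toFinset, ψu.valueAtUniformizer u :=
    valueAtUniformizer_restrict (fun x ↦ (hψures x).symm)
      (fun u hu ↦ ramificationIdx_eq_one_of_isUnramifiedIn_of_under_eq hv2 hu)
      (fun u hu ↦ hv8 u ((place_under_eq_iff_asIdeal u v).mp hu))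
  refine ⟨α, B, hv1, hv2, fun w hw ↦ ?_, hB, hBi, hinv, hχ₀v, hμ2, hμ1, fun u hu ↦ ?_, hres, hresω⟩
  · have hw' := (place_under_eq_iff_asIdeal w v).mp hw
    exact ⟨hα w hw', hv4 w hw', htw w hw', hpolv w hw⟩
  · have hu' := (place_under_eq_iff_asIdeal u v).mp hu
    have hPiK := hv10 u hu' v B hu' hB
    exact ⟨hv8 u hu', hPiK, hv11 u hu' _ hPiK⟩

end Data

/-- **Registered anchor** of this helper file (stub registry of stmt-Langlands-10902, line
`one-transparent-pane`, helper "Data" for `stub_memberSatake`): `(q^{-k/2})² = q^{-k}`. [folklore] -/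
theorem memberSatakeData_anchor : ∀ (q : ℕ) (k : ℤ), ((q : ℂ) ^ (-((k : ℂ) / 2))) ^ 2 = ((q : ℂ) ^ k)⁻¹ :=
  cpow_neg_half_sq

end Summit.Langlands.Langlands.Theorems.HostInducedRep.OneTransparentPane

end
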